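import Summits.ValiantsHypothesis.ValiantsHypothesis.Theorems.GrenetZeonAbelianizationQPZeonAnyField
import Summits.ValiantsHypothesis.ValiantsHypothesis.Theorems.GrenetZeonPolySizeQPAlgebraMatrixProductReadOut
import HarnessLib

/-!
# Hybrid Grenet / zeon representations of the permanent: the tradeoff curve
# `HasAlgDetRepr per_{a+b} ((a + b + 1) 2^a + 1) (2^b)`

Helper file for the crux `AbelianizationQP` (stmt-ValiantsHypothesis-8063, line `zeon-window`).
Between Grenet's point `(2^n - 1, 1)` and the zeon point `(n, 2^n)` of the `(m, s)` chart of the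
permanent, an INTERPOLATING FAMILY: split the columns `[n] = A ⊔ B` (`|A| = a`, `|B| = b`), run
Grenet's subset-insertion program on the subsets of `A` (one layer per row: a layered ABP on
`(n + 1) 2^a` vertices) and track the columns of `B` in the zeon algebra on `b` generators
(coefficient dimension `2^b`).  With `Q_j` the insertion of `j` (a `0/1` matrix) for `j ∈ A` and
`Q_j = ε_j · 1` (central) for `j ∈ B`, the affine matrices `M_t = Σ_j x_{j t} Q_j` satisfy
`λ_B ((M_0 ⋯ M_{n-1})_{∅, A}) = per_n` (`λ_B` = top zeon coefficient): a word `Q_{g(0)} ⋯ Q_{g(n-1)}`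
read at `(∅, A)` and at the top zeon coefficient is `1` iff `g` is a permutation
(`hybridWord_prod`, `insertion_list_prod_apply` on both sides, `injective_iff_parts`); the product
is read out by `hasAlgDetRepr_listProd_apply_readOut`.

* `hasAlgDetRepr_perPoly_hybrid` — `HasAlgDetRepr (perPoly (Fin (a + b)) K) ((a + b + 1) * 2^a + 1) (2^b)`
  over every field (`m · s ≈ (n + 1) 2^n` along the curve).

Honest framing: explicit representations (upper bounds); the crux concerns converting ARBITRARY
subexponential determinantal expressions.  No stub is closed; `VP ≠ VNP` is not touched.

## References
* B. Grenet, *An upper bound for the permanent versus determinant problem* (2011), Thm. 1.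
  [cite: Grenet2011, Thm. 1]
* C. Brand, H. Dell, T. Husfeldt, *Extensor-coding*, STOC 2018, §3. [cite: BrandDellHusfeldt2018, §3]
-/

set_option linter.dupNamespace false

noncomputable section

namespace Summit.ValiantsHypothesis.ValiantsHypothesis.Theorems.GrenetZeonAbelianizationQP

open MvPolynomial Matrix
open Literature.Computability.AlgebraicComplexity
open Summit.ValiantsHypothesis.ValiantsHypothesis.Theorems.GrenetZeonPolySizeQPAlgebra

/-! ### Lists over a sum type: left and right parts -/

section SumLists

variable {α β : Type*}

/-- Membership in the left part of a list over `α ⊕ β`. [folklore] -/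
theorem mem_filterMap_left (l : List (α ⊕ β)) (y : α) :
    y ∈ l.filterMap (Sum.elim (fun a => some a) (fun _ => none)) ↔ Sum.inl y ∈ l := by
  rw [List.mem_filterMap]
  refine ⟨?_, fun h => ⟨Sum.inl y, h, rfl⟩⟩
  rintro ⟨x, hx, hxy⟩
  rcases x with x | x
  · simp only [Sum.elim_inl, Option.some.injEq] at hxy
    rwa [← hxy]
  · exact absurd hxy (by simp)

/-- Membership in the right part of a list over `α ⊕ β`. [folklore] -/
theorem mem_filterMap_right (l : List (α ⊕ β)) (y : β) :
    y ∈ l.filterMap (Sum.elim (fun _ => none) (fun b => some b)) ↔ Sum.inr y ∈ l := by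
  rw [List.mem_filterMap]
  refine ⟨?_, fun h => ⟨Sum.inr y, h, rfl⟩⟩
  rintro ⟨x, hx, hxy⟩
  rcases x with x | x
  · exact absurd hxy (by simp)
  · simp only [Sum.elim_inr, Option.some.injEq] at hxy
    rwa [← hxy]

/-- A list over `α ⊕ β` has no duplicates iff its left part and its right part have none.
[folklore] -/
theorem nodup_iff_left_right (l : List (α ⊕ β)) :
    l.Nodup ↔ (l.filterMap (Sum.elim (fun a => some a) (fun _ => none))).Nodup ∧
      (l.filterMap (Sum.elim (fun _ => none) (fun b => some b))).Nodup := by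
  induction l with
  | nil => simp
  | cons x l ih =>
    rw [List.nodup_cons, ih]
    rcases x with y | y
    · rw [List.filterMap_cons_some
          (show Sum.elim (fun a => some a) (fun _ => none) (Sum.inl y : α ⊕ β) = some y from rfl),
        List.filterMap_cons_none
          (show Sum.elim (fun _ => none) (fun b => some b) (Sum.inl y : α ⊕ β) = none from rfl),
        List.nodup_cons, mem_filterMap_left]
      tauto
    · rw [List.filterMap_cons_none
          (show Sum.elim (fun a => some a) (fun _ => none) (Sum.inr y : α ⊕ β) = none from rfl),
        List.filterMap_cons_some
          (show Sum.elim (fun _ => none) (fun b => some b) (Sum.inr y : α ⊕ β) = some y from rfl),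
        List.nodup_cons, mem_filterMap_right]
      tauto

/-- For `g : Fin (a + b) → Fin a ⊕ Fin b`: `g` is injective iff the left part of
`(g 0, …, g (n-1))` is duplicate-free and exhausts `Fin a` and the right part is duplicate-free and
exhausts `Fin b`. [folklore] -/
theorem injective_iff_parts {a b : ℕ} (g : Fin (a + b) → Fin a ⊕ Fin b) :
    Function.Injective g ↔
      (((List.ofFn g).filterMap (Sum.elim (fun j => some j) (fun _ => none))).Nodup ∧
        (Finset.univ : Finset (Fin a)) =
          ((List.ofFn g).filterMap (Sum.elim (fun j => some j) (fun _ => none))).toFinset) ∧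
      (((List.ofFn g).filterMap (Sum.elim (fun _ => none) (fun j => some j))).Nodup ∧
        (Finset.univ : Finset (Fin b)) =
          ((List.ofFn g).filterMap (Sum.elim (fun _ => none) (fun j => some j))).toFinset) := by
  classical
  constructor
  · intro hg
    have hnd : (List.ofFn g).Nodup := List.nodup_ofFn.mpr hg
    obtain ⟨hL, hR⟩ := (nodup_iff_left_right _).mp hnd
    have hbij : Function.Bijective g := by
      rw [Fintype.bijective_iff_injective_and_card]
      exact ⟨hg, by simp⟩
    refine ⟨⟨hL, ?_⟩, ⟨hR, ?_⟩⟩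
    · ext y
      simp only [Finset.mem_univ, List.mem_toFinset, true_iff, mem_filterMap_left, List.mem_ofFn]
      exact hbij.2 (Sum.inl y)
    · ext y
      simp only [Finset.mem_univ, List.mem_toFinset, true_iff, mem_filterMap_right, List.mem_ofFn]
      exact hbij.2 (Sum.inr y)
  · rintro ⟨⟨hL, -⟩, ⟨hR, -⟩⟩
    exact List.nodup_ofFn.mp ((nodup_iff_left_right _).mpr ⟨hL, hR⟩)

end SumLists

/-! ### Words in the hybrid operators -/

section Words

variable {K : Type} [Field K] {a b : ℕ} {P : Type*} [CommRing P] [Algebra K P]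

/-- **Factorization of a hybrid word.** With `Q (inl j)` the `j`-th insertion operator on the
subsets of `Fin a` (a `0/1` matrix, mapped into `P`) and `Q (inr j) = z_j · 1` a central scalar,
a word `Q_{x_1} ⋯ Q_{x_r}` equals `(∏_{right part} z) · (insertion word of the left part)`.
[cite: BrandDellHusfeldt2018, §3] -/
theorem hybridWord_prod (z : Fin b → P) (js : List (Fin a ⊕ Fin b)) :
    (js.map (Sum.elim
        (fun j : Fin a => (Matrix.of fun S T : Finset (Fin a) =>
          if j ∉ S ∧ T = insert j S then (1 : K) else 0).map (algebraMap K P))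
        (fun j : Fin b => z j • (1 : Matrix (Finset (Fin a)) (Finset (Fin a)) P)))).prod =
      ((js.filterMap (Sum.elim (fun _ => none) (fun j => some j))).map z).prod •
        (((js.filterMap (Sum.elim (fun j => some j) (fun _ => none))).map fun j : Fin a =>
          (Matrix.of fun S T : Finset (Fin a) =>
            if j ∉ S ∧ T = insert j S then (1 : K) else 0)).prod.map (algebraMap K P)) := by
  induction js with
  | nil =>
    rw [List.map_nil, List.prod_nil, List.filterMap_nil, List.filterMap_nil, List.map_nil,
      List.prod_nil, List.map_nil, List.prod_nil, one_smul, Matrix.map_one _ (map_zero _) (map_one _)]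
  | cons x js ih =>
    rw [List.map_cons, List.prod_cons, ih]
    rcases x with j | j
    · rw [List.filterMap_cons_none
          (show Sum.elim (fun _ => none) (fun j : Fin b => some j) (Sum.inl j : Fin a ⊕ Fin b) = none
            from rfl),
        List.filterMap_cons_some
          (show Sum.elim (fun j : Fin a => some j) (fun _ => none) (Sum.inl j : Fin a ⊕ Fin b) = some j
            from rfl),
        Sum.elim_inl, List.map_cons, List.prod_cons, Matrix.map_mul, Matrix.mul_smul]
    · rw [List.filterMap_cons_some
          (show Sum.elim (fun _ => none) (fun j : Fin b => some j) (Sum.inr j : Fin a ⊕ Fin b) = some j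
            from rfl),
        List.filterMap_cons_none
          (show Sum.elim (fun j : Fin a => some j) (fun _ => none) (Sum.inr j : Fin a ⊕ Fin b) = none
            from rfl),
        Sum.elim_inr, List.map_cons, List.prod_cons, smul_mul_assoc, one_mul, mul_smul]

/-- **Read-out of a hybrid word at `(∅, univ)`**: it is the scalar
`[left part duplicate-free and exhausting Fin a] · ∏_{right part} z`. [cite: Grenet2011, Thm. 1] -/
theorem hybridWord_apply_empty_univ (z : Fin b → P) (js : List (Fin a ⊕ Fin b)) :
    (js.map (Sum.elim
        (fun j : Fin a => (Matrix.of fun S T : Finset (Fin a) =>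
          if j ∉ S ∧ T = insert j S then (1 : K) else 0).map (algebraMap K P))
        (fun j : Fin b => z j • (1 : Matrix (Finset (Fin a)) (Finset (Fin a)) P)))).prod
        ∅ Finset.univ =
      ((List.filterMap (Sum.elim (fun _ => none) (fun j => some j)) js).map z).prod *
        (if (List.Nodup (List.filterMap (Sum.elim (fun j => some j) (fun _ => none)) js) ∧
              (Finset.univ : Finset (Fin a)) = List.toFinset (List.filterMap (Sum.elim (fun j => some j) (fun _ => none)) js))
          then 1 else 0) := by
  classical
  rw [hybridWord_prod, Matrix.smul_apply, Matrix.map_apply, insertion_list_prod_apply, smul_eq_mul]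
  congr 1
  simp only [Finset.notMem_empty, not_false_eq_true, implies_true, true_and, Finset.empty_union]
  split_ifs <;> simp

end Words

/-! ### The hybrid representation -/

section Hybrid
set_option maxHeartbeats 400000 in -- buildfix (bf3-g31): 160k/180k FAIL, 200k PASS at accept time; line-neutral budget line
/-- **The hybrid point of the `(m, s)` chart of the permanent.** For all `a, b` and every field
`K`: `HasAlgDetRepr (perPoly (Fin (a + b)) K) ((a + b + 1) * 2^a + 1) (2^b)`.  Coefficient algebra:
the zeon algebra `R` on `b` generators realised by the insertion operators on the subsets of
`Fin b` (`finrank_adjoin_insertion_le`); matrices: `M_t = Σ_j x_{j t} Q_j` on the subsets of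
`Fin a`; the entry `(∅, [a])` of `M_0 ⋯ M_{n-1}` is a layered ABP over `R` on `(n + 1) 2^a`
vertices (`hasAlgDetRepr_listProd_apply_readOut`), and its top zeon coefficient is `per_n`.
[cite: Grenet2011, Thm. 1] -/
theorem hasAlgDetRepr_perPoly_hybrid (K : Type) [Field K] (a b : ℕ) :
    HasAlgDetRepr (perPoly (Fin (a + b)) K) ((a + b + 1) * 2 ^ a + 1) (2 ^ b) := by
  classical
  -- the zeon algebra on `b` generators
  set ZB : Fin b → Matrix (Finset (Fin b)) (Finset (Fin b)) K := fun j =>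
    Matrix.of fun S T : Finset (Fin b) => if j ∉ S ∧ T = insert j S then (1 : K) else 0 with hZB
  have hcomm : ∀ x ∈ Set.range ZB, ∀ y ∈ Set.range ZB, x * y = y * x := by
    rintro x ⟨j, rfl⟩ y ⟨l, rfl⟩
    exact insertion_comm j l
  set Sgen : Set (Matrix (Finset (Fin b)) (Finset (Fin b)) K) := Set.range ZB with hSgen
  haveI hc : IsMulCommutative (Algebra.adjoin K Sgen) := Algebra.isMulCommutative_adjoin K hcomm
  letI : CommRing (Algebra.adjoin K Sgen) :=
    { (inferInstance : Ring (Algebra.adjoin K Sgen)) with mul_comm := mul_comm' }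
  have hZmem : ∀ j, ZB j ∈ Algebra.adjoin K Sgen := fun j => Algebra.subset_adjoin ⟨j, rfl⟩
  set z : Fin b → Algebra.adjoin K Sgen := fun j => ⟨ZB j, hZmem j⟩ with hz
  have hdim : Module.finrank K (Algebra.adjoin K Sgen) ≤ 2 ^ b := finrank_adjoin_insertion_le b
  let lB : Algebra.adjoin K Sgen →ₗ[K] K :=
    (Matrix.entryLinearMap K K (∅ : Finset (Fin b)) Finset.univ).comp
      (Algebra.adjoin K Sgen).val.toLinearMap
  have hlB : ∀ r : Algebra.adjoin K Sgen,
      lB r = (r : Matrix (Finset (Fin b)) (Finset (Fin b)) K) ∅ Finset.univ := fun r => rfl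
  -- value of `lB` on a zeon word
  have hzword : ∀ js : List (Fin b), lB ((js.map z).prod) =
      if js.Nodup ∧ (Finset.univ : Finset (Fin b)) = js.toFinset then 1 else 0 := by
    intro js
    rw [hlB, show (((js.map z).prod : Algebra.adjoin K Sgen) :
        Matrix (Finset (Fin b)) (Finset (Fin b)) K) =
      (Algebra.adjoin K Sgen).val (js.map z).prod from rfl, map_list_prod, List.map_map]
    have h := insertion_list_prod_apply (K := K) js ∅ Finset.univ
    simp only [Finset.notMem_empty, not_false_eq_true, implies_true, true_and,
      Finset.empty_union] at h
    exact h
  -- the polynomial ring over the zeon algebra and the hybrid operators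
  set n := a + b with hn
  let P := MvPolynomial (Fin n × Fin n) (Algebra.adjoin K Sgen)
  let W := Finset (Fin a)
  let QS : Fin a ⊕ Fin b → Matrix W W P := Sum.elim
    (fun j : Fin a => (Matrix.of fun S T : Finset (Fin a) =>
      if j ∉ S ∧ T = insert j S then (1 : K) else 0).map (algebraMap K P))
    (fun j : Fin b => (C (z j) : P) • (1 : Matrix W W P))
  have hQSconst : ∀ x S T, ∃ r : Algebra.adjoin K Sgen, QS x S T = C r := by
    intro x S T
    rcases x with j | j
    · refine ⟨algebraMap K _ (if j ∉ S ∧ T = insert j S then (1 : K) else 0), ?_⟩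
      simp only [QS, Sum.elim_inl, Matrix.map_apply, Matrix.of_apply]
      rw [IsScalarTower.algebraMap_apply K (Algebra.adjoin K Sgen) P, MvPolynomial.algebraMap_eq]
    · refine ⟨if S = T then z j else 0, ?_⟩
      simp only [QS, Sum.elim_inr, Matrix.smul_apply, Matrix.one_apply, smul_eq_mul]
      split_ifs <;> simp
  let e : Fin a ⊕ Fin b ≃ Fin n := finSumFinEquiv
  let Q : Fin n → Matrix W W P := fun j => QS (e.symm j)
  let M : Fin n → Matrix W W P := fun t => Matrix.of fun S T => ∑ j, X (j, t) * Q j S T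
  have hMdeg : ∀ t S T, (M t S T).totalDegree ≤ 1 := by
    intro t S T
    simp only [M, Matrix.of_apply]
    refine (totalDegree_finsetSum _ _).trans (Finset.sup_le fun j _ => ?_)
    obtain ⟨r, hr⟩ := hQSconst (e.symm j) S T
    rw [show Q j S T = C r from hr]
    refine (totalDegree_mul _ _).trans ?_
    rw [totalDegree_C, add_zero]
    rcases subsingleton_or_nontrivial (Algebra.adjoin K Sgen) with h0 | h1
    · rw [Subsingleton.elim (X (j, t) : P) 0, totalDegree_zero]
      exact Nat.zero_le _
    · rw [totalDegree_X]
  -- the commutative algebra generated by the `Q j` over `P`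
  have hQcomm : ∀ x ∈ Set.range Q, ∀ y ∈ Set.range Q, x * y = y * x := by
    rintro x ⟨j, rfl⟩ y ⟨l, rfl⟩
    simp only [Q]
    rcases e.symm j with j' | j' <;> rcases e.symm l with l' | l'
    · simp only [QS, Sum.elim_inl]
      rw [← Matrix.map_mul, ← Matrix.map_mul, insertion_comm]
    · simp only [QS, Sum.elim_inl, Sum.elim_inr]
      rw [Matrix.mul_smul, Matrix.mul_one, Matrix.smul_mul, Matrix.one_mul]
    · simp only [QS, Sum.elim_inl, Sum.elim_inr]
      rw [Matrix.mul_smul, Matrix.mul_one, Matrix.smul_mul, Matrix.one_mul]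
    · simp only [QS, Sum.elim_inr]
      rw [Matrix.mul_smul, Matrix.smul_mul, Matrix.mul_smul, Matrix.smul_mul, Matrix.one_mul,
        smul_comm]
  set Cgen : Set (Matrix W W P) := Set.range Q with hCgen
  haveI hcc : IsMulCommutative (Algebra.adjoin P Cgen) := Algebra.isMulCommutative_adjoin P hQcomm
  letI : CommRing (Algebra.adjoin P Cgen) :=
    { (inferInstance : Ring (Algebra.adjoin P Cgen)) with mul_comm := mul_comm' }
  have hQmem : ∀ j, Q j ∈ Algebra.adjoin P Cgen := fun j => Algebra.subset_adjoin ⟨j, rfl⟩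
  let q : Fin n → Algebra.adjoin P Cgen := fun j => ⟨Q j, hQmem j⟩
  let m : Fin n → Algebra.adjoin P Cgen := fun t => ∑ j, algebraMap P _ (X (j, t)) * q j
  -- `M t` is the underlying matrix of `m t`
  have hsummand : ∀ t j, (Algebra.adjoin P Cgen).val
      (algebraMap P (Algebra.adjoin P Cgen) (X (j, t)) * q j) = (X (j, t) : P) • Q j := by
    intro t j
    rw [map_mul, AlgHom.commutes, Algebra.algebraMap_eq_smul_one, smul_mul_assoc, one_mul]
    rfl
  have hmM : ∀ t, ((m t : Algebra.adjoin P Cgen) : Matrix W W P) = M t := by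
    intro t
    change (Algebra.adjoin P Cgen).val
      (∑ j, algebraMap P (Algebra.adjoin P Cgen) (X (j, t)) * q j) = M t
    rw [map_sum]
    simp only [hsummand]
    ext S T
    simp only [M, Matrix.sum_apply, Matrix.smul_apply, smul_eq_mul, Matrix.of_apply]
  -- expansion of the product in the commutative algebra
  have hexp : ∏ t, m t = ∑ g : Fin n → Fin n,
      algebraMap P (Algebra.adjoin P Cgen) (∏ t, X (g t, t)) * ∏ t, q (g t) := by
    simp only [m]
    rw [Finset.prod_univ_sum]
    simp only [Fintype.piFinset_univ]
    refine Finset.sum_congr rfl fun g _ => ?_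
    rw [Finset.prod_mul_distrib, map_prod]
  -- the list product of the `M t`
  have hlist : (List.ofFn M).prod = ((∏ t, m t : Algebra.adjoin P Cgen) : Matrix W W P) := by
    rw [← List.prod_ofFn, show ((((List.ofFn m).prod : Algebra.adjoin P Cgen)) : Matrix W W P) =
      (Algebra.adjoin P Cgen).val (List.ofFn m).prod from rfl, map_list_prod, List.map_ofFn]
    congr 1
    exact (List.ofFn_inj.mpr (funext fun t => (hmM t).symm))
  -- the combinatorial weight of a function `g : Fin n → Fin n`
  let cond : (Fin n → Fin n) → Prop := fun g =>
    List.Nodup (List.filterMap (Sum.elim (fun j => some j) (fun _ => none)) (List.ofFn (e.symm ∘ g))) ∧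
      (Finset.univ : Finset (Fin a)) = List.toFinset (List.filterMap (Sum.elim (fun j => some j) (fun _ => none)) (List.ofFn (e.symm ∘ g)))
  let w : (Fin n → Fin n) → Algebra.adjoin K Sgen := fun g =>
    ((List.filterMap (Sum.elim (fun _ => none) (fun j => some j)) (List.ofFn (e.symm ∘ g))).map z).prod * (if cond g then 1 else 0)
  -- the word of a function `g`
  have hword : ∀ g : Fin n → Fin n,
      (Algebra.adjoin P Cgen).val (∏ t, q (g t)) ∅ Finset.univ = C (w g) := by
    intro g
    rw [← List.prod_ofFn, map_list_prod, List.map_ofFn]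
    have hfun : (List.ofFn ((Algebra.adjoin P Cgen).val ∘ fun t => q (g t))) =
        (List.ofFn (e.symm ∘ g)).map QS := by
      rw [List.map_ofFn]
      rfl
    rw [hfun]
    dsimp only [QS]
    rw [hybridWord_apply_empty_univ]
    have hC : ∀ l : List (Fin b), (l.map (fun j => (C (z j) : P))).prod = C ((l.map z).prod) :=
      fun l => by rw [map_list_prod, List.map_map]; rfl
    rw [hC]
    simp only [w, cond]
    split_ifs <;> simp
  -- assemble: the `(∅, univ)` entry of the list product, and its coefficients through `lB`
  have hentry : ((List.ofFn M).prod) ∅ Finset.univ = ∑ g : Fin n → Fin n,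
      (∏ t, X (g t, t)) * C (w g) := by
    rw [hlist, hexp]
    change (Algebra.adjoin P Cgen).val (∑ g : Fin n → Fin n, algebraMap P (Algebra.adjoin P Cgen)
        (∏ t, X (g t, t)) * ∏ t, q (g t)) ∅ Finset.univ = _
    rw [map_sum, Matrix.sum_apply]
    refine Finset.sum_congr rfl fun g _ => ?_
    rw [map_mul, AlgHom.commutes, Algebra.algebraMap_eq_smul_one, smul_mul_assoc, one_mul,
      Matrix.smul_apply, smul_eq_mul, hword g]
  have hmon : ∀ g : Fin n → Fin n,
      (∏ t, X (g t, t) : P) = monomial (∑ t, Finsupp.single (g t, t) 1) 1 := by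
    intro g
    rw [monomial_sum_one]
    rfl
  have hinj : ∀ g : Fin n → Fin n, lB (w g) = if Function.Injective g then 1 else 0 := by
    intro g
    have hiff : Function.Injective g ↔ Function.Injective (e.symm ∘ g) :=
      ⟨fun h => e.symm.injective.comp h, fun h => Function.Injective.of_comp h⟩
    simp only [w]
    by_cases hg : Function.Injective g
    · rw [if_pos hg]
      have h2 := (injective_iff_parts (e.symm ∘ g)).mp (hiff.mp hg)
      rw [if_pos (show cond g from h2.1), mul_one, hzword, if_pos h2.2]
    · rw [if_neg hg]
      by_cases hA : cond g
      · rw [if_pos hA, mul_one, hzword, if_neg]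
        intro hB
        exact hg (hiff.mpr ((injective_iff_parts (e.symm ∘ g)).mpr ⟨hA, hB⟩))
      · rw [if_neg hA, mul_zero, map_zero]
  have hf : ∀ d : (Fin n × Fin n) →₀ ℕ,
      lB (coeff d (((List.ofFn M).prod) ∅ Finset.univ)) = coeff d (perPoly (Fin n) K) := by
    intro d
    rw [hentry, coeff_sum, map_sum, coeff_perPoly]
    have hterm : ∀ g : Fin n → Fin n,
        lB (coeff d ((∏ t, X (g t, t)) * C (w g))) =
          if Function.Injective g then
            (if (∑ t, Finsupp.single (g t, t) 1) = d then (1 : K) else 0) else 0 := by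
      intro g
      rw [hmon g, mul_comm, C_mul_monomial, mul_one, coeff_monomial]
      by_cases h1 : (∑ t, Finsupp.single (g t, t) 1) = d
      · rw [if_pos h1, if_pos h1]
        exact hinj g
      · rw [if_neg h1, if_neg h1, map_zero, ite_self]
    simp only [hterm]
    rw [← Finset.sum_filter]
    refine Finset.sum_bij' (fun g hg => Equiv.ofBijective g
        (Finite.injective_iff_bijective.mp (Finset.mem_filter.mp hg).2))
      (fun σ _ => (σ : Fin n → Fin n)) ?_ ?_ ?_ ?_ ?_
    · intro g hg; exact Finset.mem_univ _
    · intro σ _; exact Finset.mem_filter.mpr ⟨Finset.mem_univ _, σ.injective⟩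
    · intro g hg; rfl
    · intro σ _; ext x; rfl
    · intro g hg
      simp only [permMonomial, Equiv.ofBijective_apply]
  have h := hasAlgDetRepr_listProd_apply_readOut (Algebra.adjoin K Sgen) hdim lB M hMdeg ∅
    Finset.univ hf
  have hcard : Fintype.card W = 2 ^ a := by
    simp only [W, Fintype.card_finset, Fintype.card_fin]
  rw [hcard] at h
  exact h

end Hybrid

end Summit.ValiantsHypothesis.ValiantsHypothesis.Theorems.GrenetZeonAbelianizationQP

end
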